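import Literature.NumberTheory.Rogawski1990.ArchUnitaryThreeRegularEllipticClass   -- ★ p849192: `isClosed_unitaryGroupOfForm_antidiag_three`, `hs_inv_eq_hs_of_archThree`; via imports ★ p848127, ★ p849073
import HarnessLib

/-!
# The regular hyperbolic classes of `U(2,1) = U(Φ₃)(ℂ)`: rational normal form `h · diag(α, u, ᾱ⁻¹) · h⁻¹`, the centraliser torus and its boost character
# ((α‴) + (Z″) of the LH2 (VOL)-kit — the inputs of SLAB DESCENT at a split class; Rogawski 1990 §3.6 type (0), Knapp 1986 Ch. V §3)

Topic `NumberTheory/Rogawski1990`; namespace `Literature.NumberTheory.Rogawski1990`.  THEOREMS ONLY (no definition, no instance, no notation, no axiom, no named fact,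
no `sorry`).  Cell `pub/hodgecm-mathlib`, crux H413 (`stmt-HodgeConjecture-24833`), F0∕P3c line LH2 (closer stub `stub_N8`; letters O1″∕O3″ on `G_∞ = U(Φ₃)(L⁺ ⊗ ℝ) ≅ U(2,1)^d`);
seat LH2-p01 (g3), bricks (α‴)+(Z″) (LH2-plan (g0) «GO» 2026-09-02T04:34:13Z); lane `--supports stmt-HodgeConjecture-24833`.  COUNT-NEUTRAL kit: the algebraic inputs with which
★ `Literature.MeasureTheory.Group.quotientMeasure_setOf_descConj_le_le_inv_mul_measure` (SLAB DESCENT, p849188) is APPLIED at an actual regular hyperbolic class of `U(2,1)`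
((H′): orbit HS-ball growth at the split classes — the classes where (14.2.1)'s vanishing clause lives when the inner form is definite at the place).

NOTATION (spelled out, no `def`): `Φ₃ = antidiag(1,1,1) = Matrix.of (i+j+1 = 3)`; `U(Φ₃)(ℂ) = unitaryGroupOfForm (starRingEnd ℂ) Φ₃ ≤ GL₃(ℂ)`; the split Cartan
`T_s = {diag(a, b, ā⁻¹) ∣ a ∈ ℂˣ, |b| = 1} ≤ U(Φ₃)(ℂ)` ([Rogawski1990, §3.6 p. 31], type (0)); its regular elements `diag(α, u, ᾱ⁻¹)` with `|α| ≠ 1`, `|u| = 1` (the three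
eigenvalues `α, u, ᾱ⁻¹` are then pairwise distinct: `|ᾱ⁻¹| = |α|⁻¹`).

* §1 (Z″) **the centraliser torus of a regular hyperbolic element and its boost character.**  For `γ ∈ U(Φ₃)(ℂ)` of matrix `!![α, 0, 0; 0, u, 0; 0, 0, (star α)⁻¹]` (the
  squad's literal, LH2-p03∕p04 2026-09-02T04:37Z), `|α| ≠ 1`, `|u| = 1` (`α ≠ 0` is automatic: `γ` is a unit):
  every `t ∈ Z(γ) = Subgroup.centralizer {γ}` is DIAGONAL (`apply_eq_zero_of_mem_centralizer_of_coe_eq_diagonal`; `diagHyp_injective`: the entries are distinct) with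
  `t̄₀₀ t₂₂ = 1`, `t̄₁₁ t₁₁ = 1` (`conj_apply_zero_mul_apply_two_eq_one_of_mem_centralizer`, `conj_apply_one_mul_apply_one_eq_one_of_mem_centralizer`, `norm_apply_of_mem_centralizer`);
  `Z(γ)` is CLOSED (`isClosed_coe_centralizer_singleton`, any Hausdorff topological group — the `[hT : IsClosed ↑T]` binder of SLAB DESCENT); and the BOOST CHARACTER `χ(t) = |t₀₀|²` satisfies EXACTLY the four hypotheses `hχmul ∕ hχpos ∕ hχcont ∕ hχonto` of ★
  `quotientMeasure_setOf_descConj_le_le_inv_mul_measure` (`chi_mul`, `chi_pos`, `continuous_chi`, `chi_onto` — onto `ℝ_{>0}` through the real boosts `diag(√r, 1, 1∕√r) ∈ Z(γ)`);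
  the fifth binder `hκ` (the `χ`-shells have finite mass) is LH2-p04's ★ `measure_setOf_centralizer_normSq_mem_Icc_ne_top` (`ArchHyperbolicTorusShellThree`, p849237),
  same carrier, same literal `!![α, 0, 0; 0, u, 0; 0, 0, (star α)⁻¹]`, same `χ` — not restated here.
* §2 (α‴) **rational normal form.**  If `g ∈ U(Φ₃)(ℂ)` has separable characteristic polynomial and SOME non-unimodular root, then `g = h · γ · h⁻¹` INSIDE `U(Φ₃)(ℂ)` with `γ` of
  matrix `!![α, 0, 0; 0, u, 0; 0, 0, ᾱ⁻¹]`, `α ≠ 0`, `|α| ≠ 1`, `|u| = 1` (`exists_conj_eq_diagonal_of_separable_of_exists_norm_root_ne_one`) — the honest dichotomy complement of ★ (α″)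
  `exists_conj_eq_compactTorusRep₃_of_separable_of_norm_root_eq_one` (all roots unimodular); in particular the spectrum is FORCED to be `{α, u, ᾱ⁻¹}`.  Road: diagonalise
  `g S = S diag(d)`; the partner involution `d̄ᵢ dⱼ = 1` on the eigen-indices (★ p848127 type (0)): the non-unimodular index `k` has a partner `j ≠ k`, the third index `l` is
  self-partnered; the Gram matrix `Q = Sᴴ Φ₃ S` (★ `sub_one_mul_frameGram_apply_eq_zero`) has the zero pattern of a hyperbolic plane `⊕` a line in the frame `(s_k, s_l, s_j)`,
  `det Q = −|Q_{kj}|² Q_{ll} = −|det S|²` forces `Q_{ll} > 0`; the rescaled frame `S′ = (s_k, s_l∕√Q_{ll}, s_j∕Q_{kj})` has `S′ᴴ Φ₃ S′ = Φ₃`, i.e. `h := S′ ∈ U(Φ₃)(ℂ)`, and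
  `g S′ = S′ diag(d_k, d_l, d_j)` with `d_j = d̄_k⁻¹`.
HONEST LABEL: HC_CM is proved only modulo the 7 printed citations (2 remaining: hLiu418 = `stmt-HodgeConjecture-24832`, h413 = `stmt-HodgeConjecture-24833`) until rung 0 closes;
this file is linear algebra under the LH2 letters and pays no printed row.

## References
* [Rogawski1990] J. D. Rogawski, *Automorphic Representations of Unitary Groups in Three Variables*, Ann. of Math. Stud. 123 (1990), §3.6 p. 31 (Cartan subgroups of `U(2,1)`, type (0)),
  §3.1 p. 19, §1.9 p. 8.
* [Knapp1986] A. W. Knapp, *Representation Theory of Semisimple Groups*, PMS 36 (1986), Ch. V §3 (Cartan subgroups, regular elements and their centralisers).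
* [HornJohnson2013] R. A. Horn, C. R. Johnson, *Matrix Analysis*, 2nd ed. (2013), Thm. 1.3.9, Thm. 4.5.8.
* [BeuzartPlessis2020Asterisque] R. Beuzart-Plessis, Astérisque 418 (2020), §1.2 (1.2.2), (1.2.4) p. 21; §1.8 p. 39 (orbit-norm estimates at split tori).
-/

set_option autoImplicit false

noncomputable section

open Matrix
open Literature.NumberTheory.Automorphic
open scoped MatrixGroups ComplexConjugate

namespace Literature.NumberTheory.Rogawski1990

/-! ## §0 Plumbing -/

section Plumbing

/-- One squared entry is at most the Hilbert–Schmidt sum. [folklore] -/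
private theorem sq_norm_apply_le_hs₃' (M : Matrix (Fin 3) (Fin 3) ℂ) (a b : Fin 3) :
    ‖M a b‖ ^ 2 ≤ ∑ i : Fin 3, ∑ j : Fin 3, ‖M i j‖ ^ 2 := by
  calc ‖M a b‖ ^ 2 ≤ ∑ j : Fin 3, ‖M a j‖ ^ 2 :=
        Finset.single_le_sum (f := fun j => ‖M a j‖ ^ 2) (fun j _ => by positivity) (Finset.mem_univ b)
    _ ≤ ∑ i : Fin 3, ∑ j : Fin 3, ‖M i j‖ ^ 2 :=
        Finset.single_le_sum (f := fun i => ∑ j : Fin 3, ‖M i j‖ ^ 2) (fun i _ => by positivity) (Finset.mem_univ a)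

/-- `|M_{ab}| ≤ √(Σ|M_{ij}|²)`. [folklore] -/
private theorem norm_apply_le_sqrt_hs₃' (M : Matrix (Fin 3) (Fin 3) ℂ) (a b : Fin 3) :
    ‖M a b‖ ≤ Real.sqrt (∑ i : Fin 3, ∑ j : Fin 3, ‖M i j‖ ^ 2) := by
  have h := Real.abs_le_sqrt (sq_norm_apply_le_hs₃' M a b)
  rwa [abs_of_nonneg (norm_nonneg _)] at h

/-- `Φ₃` as a matrix literal. [folklore] -/
private theorem antidiag₃_eq_lit' :
    (Matrix.of fun i j : Fin 3 => if i.val + j.val + 1 = 3 then (1 : ℂ) else 0) = !![(0 : ℂ), 0, 1; 0, 1, 0; 1, 0, 0] := by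
  ext i j
  fin_cases i <;> fin_cases j <;> rfl

/-- `(M.map conj)ᵀ = Mᴴ`. [folklore] -/
private theorem transpose_map_starRingEnd' (M : Matrix (Fin 3) (Fin 3) ℂ) : (M.map (starRingEnd ℂ))ᵀ = Mᴴ := by
  ext i j
  rfl

/-- The diagonal literal `!![α, 0, 0; 0, u, 0; 0, 0, ᾱ⁻¹]` is `diagonal (α, u, ᾱ⁻¹)`. [folklore] -/
private theorem diagHyp_lit_eq_diagonal (α u : ℂ) :
    (!![α, 0, 0; 0, u, 0; 0, 0, (star α)⁻¹] : Matrix (Fin 3) (Fin 3) ℂ) = diagonal ![α, u, (starRingEnd ℂ α)⁻¹] := by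
  ext i j
  fin_cases i <;> fin_cases j <;> rfl

/-- Three pairwise distinct indices exhaust `Fin 3`. [folklore] -/
private theorem fin3_cases_of_distinct : ∀ k l j b : Fin 3, k ≠ l → k ≠ j → l ≠ j → b = k ∨ b = l ∨ b = j := by decide

end Plumbing

/-! ## §1 (Z″) The centraliser torus of `diag(α, u, ᾱ⁻¹)` in `U(Φ₃)(ℂ)` and its boost character `χ(t) = |t₀₀|²` -/

section CentraliserTorus

/-- **Centralisers are closed** in a Hausdorff topological group (the `[hT : IsClosed ↑T]` binder of ★ SLAB DESCENT at `T = Z(γ)`). [folklore] [cite: Knapp1986, Ch. V §3] -/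
theorem isClosed_coe_centralizer_singleton {G : Type*} [Group G] [TopologicalSpace G] [IsTopologicalGroup G] [T2Space G] (γ : G) :
    IsClosed ((Subgroup.centralizer ({γ} : Set G)) : Set G) := by
  have e : ((Subgroup.centralizer ({γ} : Set G)) : Set G) = {y | y * γ = γ * y} := by
    ext y
    exact Subgroup.mem_centralizer_singleton_iff
  rw [e]
  exact isClosed_eq (continuous_id.mul continuous_const) (continuous_const.mul continuous_id)

variable {γ : ↥(unitaryGroupOfForm (starRingEnd ℂ) (Matrix.of fun i j : Fin 3 => if i.val + j.val + 1 = 3 then (1 : ℂ) else 0))} {α u : ℂ}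

/-- `α ≠ 0` for a unit of matrix `diag(α, u, ᾱ⁻¹)`. [folklore] -/
private theorem alpha_ne_zero (hγ : ((γ : GL (Fin 3) ℂ) : Matrix (Fin 3) (Fin 3) ℂ) = !![α, 0, 0; 0, u, 0; 0, 0, (star α)⁻¹]) : α ≠ 0 := by
  intro h0
  have hu : IsUnit ((γ : GL (Fin 3) ℂ) : Matrix (Fin 3) (Fin 3) ℂ).det :=
    (Matrix.isUnit_iff_isUnit_det _).1 (γ : GL (Fin 3) ℂ).isUnit
  rw [hγ, diagHyp_lit_eq_diagonal, det_diagonal, Fin.prod_univ_three] at hu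
  simp [h0] at hu

/-- The three eigenvalues `α, u, ᾱ⁻¹` (`α ≠ 0`, `|α| ≠ 1`, `|u| = 1`) of a regular hyperbolic element are pairwise distinct. [cite: Rogawski1990, §3.6 p. 31] -/
theorem diagHyp_injective (hα0 : α ≠ 0) (hα : ‖α‖ ≠ 1) (hu : ‖u‖ = 1) : Function.Injective (![α, u, (starRingEnd ℂ α)⁻¹] : Fin 3 → ℂ) := by
  have hpos : 0 < ‖α‖ := norm_pos_iff.2 hα0
  have h01 : α ≠ u := fun h => hα (by rw [h, hu])
  have h12 : u ≠ (starRingEnd ℂ α)⁻¹ := by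
    intro h
    have h' := congrArg (fun z : ℂ => ‖z‖) h
    simp only [norm_inv, RCLike.norm_conj, hu] at h'
    -- `1 = ‖α‖⁻¹`
    have : ‖α‖ = 1 := by
      have h2 : ‖α‖ * 1 = ‖α‖ * ‖α‖⁻¹ := by rw [← h']
      rw [mul_inv_cancel₀ hpos.ne', mul_one] at h2
      exact h2
    exact hα this
  have h02 : α ≠ (starRingEnd ℂ α)⁻¹ := by
    intro h
    have h' := congrArg (fun z : ℂ => ‖z‖) h
    simp only [norm_inv, RCLike.norm_conj] at h'
    -- `‖α‖ = ‖α‖⁻¹`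
    have h1 : ‖α‖ * ‖α‖ = 1 := by
      have h2 : ‖α‖ * ‖α‖ = ‖α‖ * ‖α‖⁻¹ := by rw [← h']
      rw [mul_inv_cancel₀ hpos.ne'] at h2
      exact h2
    exact hα (by nlinarith [h1, hpos])
  intro i j hij
  fin_cases i <;> fin_cases j
  · rfl
  · exact absurd hij h01
  · exact absurd hij h02
  · exact absurd hij.symm h01
  · rfl
  · exact absurd hij h12
  · exact absurd hij.symm h02
  · exact absurd hij.symm h12
  · rfl

end CentraliserTorus

section Torus

variable {γ : ↥(unitaryGroupOfForm (starRingEnd ℂ) (Matrix.of fun i j : Fin 3 => if i.val + j.val + 1 = 3 then (1 : ℂ) else 0))} {α u : ℂ}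
  (hγ : ((γ : GL (Fin 3) ℂ) : Matrix (Fin 3) (Fin 3) ℂ) = !![α, 0, 0; 0, u, 0; 0, 0, (star α)⁻¹]) (hu : ‖u‖ = 1) (hα1 : ‖α‖ ≠ 1)

include hγ hu hα1 in
/-- **Elements of `Z(γ)` are DIAGONAL** for `γ` of matrix `diag(α, u, ᾱ⁻¹)` regular hyperbolic (a matrix commuting with a diagonal matrix with distinct entries is diagonal).
[cite: Knapp1986, Ch. V §3] [cite: Rogawski1990, §3.6 p. 31] -/
theorem apply_eq_zero_of_mem_centralizer_of_coe_eq_diagonal {t : ↥(unitaryGroupOfForm (starRingEnd ℂ) (Matrix.of fun i j : Fin 3 => if i.val + j.val + 1 = 3 then (1 : ℂ) else 0))} (ht : t ∈ Subgroup.centralizer ({γ} : Set ↥(unitaryGroupOfForm (starRingEnd ℂ) (Matrix.of fun i j : Fin 3 => if i.val + j.val + 1 = 3 then (1 : ℂ) else 0)))) {i j : Fin 3} (hij : i ≠ j) :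
    ((t : GL (Fin 3) ℂ) : Matrix (Fin 3) (Fin 3) ℂ) i j = 0 := by
  have hinj := diagHyp_injective (alpha_ne_zero hγ) hα1 hu
  have h := Subgroup.mem_centralizer_singleton_iff.1 ht
  have hm : ((t : GL (Fin 3) ℂ) : Matrix (Fin 3) (Fin 3) ℂ) * diagonal ![α, u, (starRingEnd ℂ α)⁻¹] =
      diagonal ![α, u, (starRingEnd ℂ α)⁻¹] * ((t : GL (Fin 3) ℂ) : Matrix (Fin 3) (Fin 3) ℂ) := by
    have h' := congrArg (fun z : ↥(unitaryGroupOfForm (starRingEnd ℂ) (Matrix.of fun i j : Fin 3 => if i.val + j.val + 1 = 3 then (1 : ℂ) else 0)) => (((z : GL (Fin 3) ℂ)) : Matrix (Fin 3) (Fin 3) ℂ)) h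
    simp only [Subgroup.coe_mul, Units.val_mul, hγ, diagHyp_lit_eq_diagonal] at h'
    exact h'
  have hij' := congrFun (congrFun hm i) j
  rw [mul_diagonal, diagonal_mul] at hij'
  -- `t_ij d_j = d_i t_ij` with `d_i ≠ d_j`
  have hne : (![α, u, (starRingEnd ℂ α)⁻¹] : Fin 3 → ℂ) j - (![α, u, (starRingEnd ℂ α)⁻¹] : Fin 3 → ℂ) i ≠ 0 :=
    sub_ne_zero.2 fun h => hij (hinj h).symm
  have : ((t : GL (Fin 3) ℂ) : Matrix (Fin 3) (Fin 3) ℂ) i j * ((![α, u, (starRingEnd ℂ α)⁻¹] : Fin 3 → ℂ) j - (![α, u, (starRingEnd ℂ α)⁻¹] : Fin 3 → ℂ) i) = 0 := by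
    rw [mul_sub, hij']; ring
  exact (mul_eq_zero.1 this).resolve_right hne

include hγ hu hα1 in
/-- **Unitarity of `t ∈ Z(γ)` on the hyperbolic pair**: `t̄₀₀ · t₂₂ = 1` (entry `(0,2)` of `tᴴ Φ₃ t = Φ₃` for diagonal `t`). [cite: Rogawski1990, §3.6 p. 31; §1.9 p. 8] -/
theorem conj_apply_zero_mul_apply_two_eq_one_of_mem_centralizer {t : ↥(unitaryGroupOfForm (starRingEnd ℂ) (Matrix.of fun i j : Fin 3 => if i.val + j.val + 1 = 3 then (1 : ℂ) else 0))} (ht : t ∈ Subgroup.centralizer ({γ} : Set ↥(unitaryGroupOfForm (starRingEnd ℂ) (Matrix.of fun i j : Fin 3 => if i.val + j.val + 1 = 3 then (1 : ℂ) else 0)))) :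
    starRingEnd ℂ (((t : GL (Fin 3) ℂ) : Matrix (Fin 3) (Fin 3) ℂ) 0 0) * ((t : GL (Fin 3) ℂ) : Matrix (Fin 3) (Fin 3) ℂ) 2 2 = 1 := by
  have h0 := fun i j (hij : i ≠ j) => apply_eq_zero_of_mem_centralizer_of_coe_eq_diagonal hγ hu hα1 ht hij
  set M : Matrix (Fin 3) (Fin 3) ℂ := ((t : GL (Fin 3) ℂ) : Matrix (Fin 3) (Fin 3) ℂ) with hM
  have hmem : (M.map (starRingEnd ℂ))ᵀ * (Matrix.of fun i j : Fin 3 => if i.val + j.val + 1 = 3 then (1 : ℂ) else 0) * M = (Matrix.of fun i j : Fin 3 => if i.val + j.val + 1 = 3 then (1 : ℂ) else 0) := t.2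
  have h02 := congrFun (congrFun hmem 0) 2
  rw [antidiag₃_eq_lit'] at h02
  simp only [Matrix.mul_apply, Fin.sum_univ_three, transpose_apply, map_apply, h0 0 2 (by decide), h0 1 0 (by decide),
    h0 1 2 (by decide), h0 2 0 (by decide)] at h02
  simpa using h02

include hγ hu hα1 in
/-- **Unitarity of `t ∈ Z(γ)` on the anisotropic line**: `t̄₁₁ · t₁₁ = 1`. [cite: Rogawski1990, §3.6 p. 31; §1.9 p. 8] -/
theorem conj_apply_one_mul_apply_one_eq_one_of_mem_centralizer {t : ↥(unitaryGroupOfForm (starRingEnd ℂ) (Matrix.of fun i j : Fin 3 => if i.val + j.val + 1 = 3 then (1 : ℂ) else 0))} (ht : t ∈ Subgroup.centralizer ({γ} : Set ↥(unitaryGroupOfForm (starRingEnd ℂ) (Matrix.of fun i j : Fin 3 => if i.val + j.val + 1 = 3 then (1 : ℂ) else 0)))) :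
    starRingEnd ℂ (((t : GL (Fin 3) ℂ) : Matrix (Fin 3) (Fin 3) ℂ) 1 1) * ((t : GL (Fin 3) ℂ) : Matrix (Fin 3) (Fin 3) ℂ) 1 1 = 1 := by
  have h0 := fun i j (hij : i ≠ j) => apply_eq_zero_of_mem_centralizer_of_coe_eq_diagonal hγ hu hα1 ht hij
  set M : Matrix (Fin 3) (Fin 3) ℂ := ((t : GL (Fin 3) ℂ) : Matrix (Fin 3) (Fin 3) ℂ) with hM
  have hmem : (M.map (starRingEnd ℂ))ᵀ * (Matrix.of fun i j : Fin 3 => if i.val + j.val + 1 = 3 then (1 : ℂ) else 0) * M = (Matrix.of fun i j : Fin 3 => if i.val + j.val + 1 = 3 then (1 : ℂ) else 0) := t.2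
  have h11 := congrFun (congrFun hmem 1) 1
  rw [antidiag₃_eq_lit'] at h11
  simp only [Matrix.mul_apply, Fin.sum_univ_three, transpose_apply, map_apply, h0 0 1 (by decide), h0 2 1 (by decide)] at h11
  simpa using h11

include hγ hu hα1 in
/-- `|t₀₀| · |t₂₂| = 1` and `|t₁₁| = 1` for `t ∈ Z(γ)`. [cite: Rogawski1990, §3.6 p. 31] -/
theorem norm_apply_of_mem_centralizer {t : ↥(unitaryGroupOfForm (starRingEnd ℂ) (Matrix.of fun i j : Fin 3 => if i.val + j.val + 1 = 3 then (1 : ℂ) else 0))} (ht : t ∈ Subgroup.centralizer ({γ} : Set ↥(unitaryGroupOfForm (starRingEnd ℂ) (Matrix.of fun i j : Fin 3 => if i.val + j.val + 1 = 3 then (1 : ℂ) else 0)))) :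
    ‖((t : GL (Fin 3) ℂ) : Matrix (Fin 3) (Fin 3) ℂ) 0 0‖ * ‖((t : GL (Fin 3) ℂ) : Matrix (Fin 3) (Fin 3) ℂ) 2 2‖ = 1 ∧
      ‖((t : GL (Fin 3) ℂ) : Matrix (Fin 3) (Fin 3) ℂ) 1 1‖ = 1 := by
  constructor
  · have h := congrArg (fun z : ℂ => ‖z‖) (conj_apply_zero_mul_apply_two_eq_one_of_mem_centralizer hγ hu hα1 ht)
    simpa only [norm_mul, RCLike.norm_conj, norm_one] using h
  · have h := congrArg (fun z : ℂ => ‖z‖) (conj_apply_one_mul_apply_one_eq_one_of_mem_centralizer hγ hu hα1 ht)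
    simp only [norm_mul, RCLike.norm_conj, norm_one] at h
    nlinarith [norm_nonneg (((t : GL (Fin 3) ℂ) : Matrix (Fin 3) (Fin 3) ℂ) 1 1)]

include hγ hu hα1 in
/-- **`hχmul`** of ★ SLAB DESCENT for the boost character `χ(t) = |t₀₀|²` on `T = Z(γ)`: `χ(s t) = χ(s) χ(t)` (diagonal matrices). [cite: BeuzartPlessis2020Asterisque, §1.8 p. 39] -/
theorem chi_mul (s t : ↥(Subgroup.centralizer ({γ} : Set ↥(unitaryGroupOfForm (starRingEnd ℂ) (Matrix.of fun i j : Fin 3 => if i.val + j.val + 1 = 3 then (1 : ℂ) else 0))))) :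
    ‖(((s * t : ↥(Subgroup.centralizer ({γ} : Set ↥(unitaryGroupOfForm (starRingEnd ℂ) (Matrix.of fun i j : Fin 3 => if i.val + j.val + 1 = 3 then (1 : ℂ) else 0))))) : ↥(unitaryGroupOfForm (starRingEnd ℂ) (Matrix.of fun i j : Fin 3 => if i.val + j.val + 1 = 3 then (1 : ℂ) else 0))) : GL (Fin 3) ℂ).val 0 0‖ ^ 2 =
      ‖(((s : ↥(Subgroup.centralizer ({γ} : Set ↥(unitaryGroupOfForm (starRingEnd ℂ) (Matrix.of fun i j : Fin 3 => if i.val + j.val + 1 = 3 then (1 : ℂ) else 0))))) : ↥(unitaryGroupOfForm (starRingEnd ℂ) (Matrix.of fun i j : Fin 3 => if i.val + j.val + 1 = 3 then (1 : ℂ) else 0))) : GL (Fin 3) ℂ).val 0 0‖ ^ 2 *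
        ‖(((t : ↥(Subgroup.centralizer ({γ} : Set ↥(unitaryGroupOfForm (starRingEnd ℂ) (Matrix.of fun i j : Fin 3 => if i.val + j.val + 1 = 3 then (1 : ℂ) else 0))))) : ↥(unitaryGroupOfForm (starRingEnd ℂ) (Matrix.of fun i j : Fin 3 => if i.val + j.val + 1 = 3 then (1 : ℂ) else 0))) : GL (Fin 3) ℂ).val 0 0‖ ^ 2 := by
  have hs0 := fun i j (hij : i ≠ j) => apply_eq_zero_of_mem_centralizer_of_coe_eq_diagonal hγ hu hα1 s.2 hij
  have e : (((s * t : ↥(Subgroup.centralizer ({γ} : Set ↥(unitaryGroupOfForm (starRingEnd ℂ) (Matrix.of fun i j : Fin 3 => if i.val + j.val + 1 = 3 then (1 : ℂ) else 0))))) : ↥(unitaryGroupOfForm (starRingEnd ℂ) (Matrix.of fun i j : Fin 3 => if i.val + j.val + 1 = 3 then (1 : ℂ) else 0))) : GL (Fin 3) ℂ).val 0 0 =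
      (((s : ↥(Subgroup.centralizer ({γ} : Set ↥(unitaryGroupOfForm (starRingEnd ℂ) (Matrix.of fun i j : Fin 3 => if i.val + j.val + 1 = 3 then (1 : ℂ) else 0))))) : ↥(unitaryGroupOfForm (starRingEnd ℂ) (Matrix.of fun i j : Fin 3 => if i.val + j.val + 1 = 3 then (1 : ℂ) else 0))) : GL (Fin 3) ℂ).val 0 0 * (((t : ↥(Subgroup.centralizer ({γ} : Set ↥(unitaryGroupOfForm (starRingEnd ℂ) (Matrix.of fun i j : Fin 3 => if i.val + j.val + 1 = 3 then (1 : ℂ) else 0))))) : ↥(unitaryGroupOfForm (starRingEnd ℂ) (Matrix.of fun i j : Fin 3 => if i.val + j.val + 1 = 3 then (1 : ℂ) else 0))) : GL (Fin 3) ℂ).val 0 0 := by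
    show ((((s : ↥(unitaryGroupOfForm (starRingEnd ℂ) (Matrix.of fun i j : Fin 3 => if i.val + j.val + 1 = 3 then (1 : ℂ) else 0))) : GL (Fin 3) ℂ) * ((t : ↥(unitaryGroupOfForm (starRingEnd ℂ) (Matrix.of fun i j : Fin 3 => if i.val + j.val + 1 = 3 then (1 : ℂ) else 0))) : GL (Fin 3) ℂ) : GL (Fin 3) ℂ)).val 0 0 = _
    rw [Units.val_mul, Matrix.mul_apply, Fin.sum_univ_three]
    have h1 : ((s : ↥(unitaryGroupOfForm (starRingEnd ℂ) (Matrix.of fun i j : Fin 3 => if i.val + j.val + 1 = 3 then (1 : ℂ) else 0))) : GL (Fin 3) ℂ).val 0 1 = 0 := hs0 0 1 (by decide)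
    have h2 : ((s : ↥(unitaryGroupOfForm (starRingEnd ℂ) (Matrix.of fun i j : Fin 3 => if i.val + j.val + 1 = 3 then (1 : ℂ) else 0))) : GL (Fin 3) ℂ).val 0 2 = 0 := hs0 0 2 (by decide)
    rw [h1, h2, zero_mul, zero_mul, add_zero, add_zero]
  rw [e, norm_mul, mul_pow]

include hγ hu hα1 in
/-- **`hχpos`**: `0 < χ(t) = |t₀₀|²` on `Z(γ)` (`t̄₀₀ t₂₂ = 1`). [cite: BeuzartPlessis2020Asterisque, §1.8 p. 39] -/
theorem chi_pos (t : ↥(Subgroup.centralizer ({γ} : Set ↥(unitaryGroupOfForm (starRingEnd ℂ) (Matrix.of fun i j : Fin 3 => if i.val + j.val + 1 = 3 then (1 : ℂ) else 0))))) :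
    0 < ‖(((t : ↥(Subgroup.centralizer ({γ} : Set ↥(unitaryGroupOfForm (starRingEnd ℂ) (Matrix.of fun i j : Fin 3 => if i.val + j.val + 1 = 3 then (1 : ℂ) else 0))))) : ↥(unitaryGroupOfForm (starRingEnd ℂ) (Matrix.of fun i j : Fin 3 => if i.val + j.val + 1 = 3 then (1 : ℂ) else 0))) : GL (Fin 3) ℂ).val 0 0‖ ^ 2 := by
  have h := (norm_apply_of_mem_centralizer hγ hu hα1 t.2).1
  have hne : ‖(((t : ↥(Subgroup.centralizer ({γ} : Set ↥(unitaryGroupOfForm (starRingEnd ℂ) (Matrix.of fun i j : Fin 3 => if i.val + j.val + 1 = 3 then (1 : ℂ) else 0))))) : ↥(unitaryGroupOfForm (starRingEnd ℂ) (Matrix.of fun i j : Fin 3 => if i.val + j.val + 1 = 3 then (1 : ℂ) else 0))) : GL (Fin 3) ℂ).val 0 0‖ ≠ 0 := by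
    intro h0
    have : ‖((((t : ↥(Subgroup.centralizer ({γ} : Set ↥(unitaryGroupOfForm (starRingEnd ℂ) (Matrix.of fun i j : Fin 3 => if i.val + j.val + 1 = 3 then (1 : ℂ) else 0))))) : ↥(unitaryGroupOfForm (starRingEnd ℂ) (Matrix.of fun i j : Fin 3 => if i.val + j.val + 1 = 3 then (1 : ℂ) else 0))) : GL (Fin 3) ℂ) : Matrix (Fin 3) (Fin 3) ℂ) 0 0‖ = 0 := h0
    rw [this, zero_mul] at h
    exact zero_ne_one h
  positivity

omit hγ hu hα1 in
/-- **`hχcont`**: `χ(t) = |t₀₀|²` is continuous on `Z(γ)`. [folklore] [cite: BeuzartPlessis2020Asterisque, §1.8 p. 39] -/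
theorem continuous_chi :
    Continuous fun t : ↥(Subgroup.centralizer ({γ} : Set ↥(unitaryGroupOfForm (starRingEnd ℂ) (Matrix.of fun i j : Fin 3 => if i.val + j.val + 1 = 3 then (1 : ℂ) else 0)))) => ‖(((t : ↥(Subgroup.centralizer ({γ} : Set ↥(unitaryGroupOfForm (starRingEnd ℂ) (Matrix.of fun i j : Fin 3 => if i.val + j.val + 1 = 3 then (1 : ℂ) else 0))))) : ↥(unitaryGroupOfForm (starRingEnd ℂ) (Matrix.of fun i j : Fin 3 => if i.val + j.val + 1 = 3 then (1 : ℂ) else 0))) : GL (Fin 3) ℂ).val 0 0‖ ^ 2 := by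
  have h1 : Continuous fun t : ↥(Subgroup.centralizer ({γ} : Set ↥(unitaryGroupOfForm (starRingEnd ℂ) (Matrix.of fun i j : Fin 3 => if i.val + j.val + 1 = 3 then (1 : ℂ) else 0)))) => (((t : ↥(unitaryGroupOfForm (starRingEnd ℂ) (Matrix.of fun i j : Fin 3 => if i.val + j.val + 1 = 3 then (1 : ℂ) else 0))) : GL (Fin 3) ℂ) : Matrix (Fin 3) (Fin 3) ℂ) :=
    Units.continuous_val.comp (continuous_subtype_val.comp continuous_subtype_val)
  exact ((continuous_apply 0).comp ((continuous_apply 0).comp h1)).norm.pow 2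

include hγ in
/-- **`hχonto`**: the boosts `diag(√r, 1, 1∕√r)` (`r > 0`) lie in `Z(γ)` and have `χ = r` — `χ` is onto `ℝ_{>0}`. [cite: Rogawski1990, §3.6 p. 31] [cite: BeuzartPlessis2020Asterisque, §1.8 p. 39] -/
theorem chi_onto (r : ℝ) (hr : 0 < r) :
    ∃ t : ↥(Subgroup.centralizer ({γ} : Set ↥(unitaryGroupOfForm (starRingEnd ℂ) (Matrix.of fun i j : Fin 3 => if i.val + j.val + 1 = 3 then (1 : ℂ) else 0)))), ‖(((t : ↥(Subgroup.centralizer ({γ} : Set ↥(unitaryGroupOfForm (starRingEnd ℂ) (Matrix.of fun i j : Fin 3 => if i.val + j.val + 1 = 3 then (1 : ℂ) else 0))))) : ↥(unitaryGroupOfForm (starRingEnd ℂ) (Matrix.of fun i j : Fin 3 => if i.val + j.val + 1 = 3 then (1 : ℂ) else 0))) : GL (Fin 3) ℂ).val 0 0‖ ^ 2 = r := by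
  have hs : 0 < Real.sqrt r := Real.sqrt_pos.2 hr
  have hsC : ((Real.sqrt r : ℝ) : ℂ) ≠ 0 := Complex.ofReal_ne_zero.2 hs.ne'
  -- the boost as a unit
  set B : GL (Fin 3) ℂ := ⟨diagonal ![((Real.sqrt r : ℝ) : ℂ), 1, ((Real.sqrt r : ℝ) : ℂ)⁻¹], diagonal ![((Real.sqrt r : ℝ) : ℂ)⁻¹, 1, ((Real.sqrt r : ℝ) : ℂ)],
    by rw [diagonal_mul_diagonal]; ext i j; fin_cases i <;> fin_cases j <;> simp [diagonal, mul_inv_cancel₀ hsC, inv_mul_cancel₀ hsC],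
    by rw [diagonal_mul_diagonal]; ext i j; fin_cases i <;> fin_cases j <;> simp [diagonal, mul_inv_cancel₀ hsC, inv_mul_cancel₀ hsC]⟩ with hB
  have hBval : ((B : GL (Fin 3) ℂ) : Matrix (Fin 3) (Fin 3) ℂ) = diagonal ![((Real.sqrt r : ℝ) : ℂ), 1, ((Real.sqrt r : ℝ) : ℂ)⁻¹] := rfl
  have hconj : starRingEnd ℂ ((Real.sqrt r : ℝ) : ℂ) = ((Real.sqrt r : ℝ) : ℂ) := Complex.conj_ofReal _
  have hBmem : B ∈ unitaryGroupOfForm (starRingEnd ℂ) (Matrix.of fun i j : Fin 3 => if i.val + j.val + 1 = 3 then (1 : ℂ) else 0) := by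
    rw [mem_unitaryGroupOfForm_iff, hBval, antidiag₃_eq_lit']
    ext i j
    fin_cases i <;> fin_cases j <;>
      simp [Matrix.mul_apply, Fin.sum_univ_three, diagonal, hconj, mul_inv_cancel₀ hsC, inv_mul_cancel₀ hsC]
  have hBZ : (⟨B, hBmem⟩ : ↥(unitaryGroupOfForm (starRingEnd ℂ) (Matrix.of fun i j : Fin 3 => if i.val + j.val + 1 = 3 then (1 : ℂ) else 0))) ∈ Subgroup.centralizer ({γ} : Set ↥(unitaryGroupOfForm (starRingEnd ℂ) (Matrix.of fun i j : Fin 3 => if i.val + j.val + 1 = 3 then (1 : ℂ) else 0))) := by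
    rw [Subgroup.mem_centralizer_singleton_iff]
    apply Subtype.ext
    apply Units.ext
    show ((B : GL (Fin 3) ℂ) : Matrix (Fin 3) (Fin 3) ℂ) * ((γ : GL (Fin 3) ℂ) : Matrix (Fin 3) (Fin 3) ℂ) =
      ((γ : GL (Fin 3) ℂ) : Matrix (Fin 3) (Fin 3) ℂ) * ((B : GL (Fin 3) ℂ) : Matrix (Fin 3) (Fin 3) ℂ)
    rw [hBval, hγ, diagHyp_lit_eq_diagonal, diagonal_mul_diagonal, diagonal_mul_diagonal]
    congr 1
    funext i
    exact mul_comm _ _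
  refine ⟨⟨⟨B, hBmem⟩, hBZ⟩, ?_⟩
  show ‖(diagonal ![((Real.sqrt r : ℝ) : ℂ), 1, ((Real.sqrt r : ℝ) : ℂ)⁻¹] : Matrix (Fin 3) (Fin 3) ℂ) 0 0‖ ^ 2 = r
  rw [diagonal_apply_eq]
  simp only [Matrix.cons_val_zero, Complex.norm_real, Real.norm_eq_abs, abs_of_pos hs, Real.sq_sqrt hr.le]

end Torus


/-! ## §2 (α‴) The rational normal form of a regular hyperbolic element of `U(Φ₃)(ℂ)` -/

section NormalForm

/-- `det Φ₃ = −1`. [cite: Rogawski1990, §1.9 p. 8] -/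
private theorem det_antidiag₃' : (Matrix.of fun i j : Fin 3 => if i.val + j.val + 1 = 3 then (1 : ℂ) else 0).det = -1 := by
  rw [Matrix.det_fin_three]
  simp [Matrix.of_apply]

/-- `Φ₃` is Hermitian. [cite: Rogawski1990, §1.9 p. 8] -/
private theorem conjTranspose_antidiag₃' :
    (Matrix.of fun i j : Fin 3 => if i.val + j.val + 1 = 3 then (1 : ℂ) else 0)ᴴ = Matrix.of fun i j : Fin 3 => if i.val + j.val + 1 = 3 then (1 : ℂ) else 0 := by
  ext i j
  fin_cases i <;> fin_cases j <;> simp [Matrix.conjTranspose_apply]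

/-- **(α‴) RATIONAL NORMAL FORM OF A REGULAR HYPERBOLIC ELEMENT OF `U(2,1)`.**  Let `g ∈ U(Φ₃)(ℂ)` have separable characteristic polynomial and a root of absolute value
`≠ 1`.  Then there are `h, γ ∈ U(Φ₃)(ℂ)` and `α, u ∈ ℂ` with `α ≠ 0`, `|α| ≠ 1`, `|u| = 1`, `γ` of matrix `diag(α, u, ᾱ⁻¹)` and `g = h γ h⁻¹` IN `U(Φ₃)(ℂ)` — so the spectrum of `g` is
forced to be `{α, u, ᾱ⁻¹}` (type (0) of [Rogawski1990, §3.6]); the dichotomy complement of ★ `exists_conj_eq_compactTorusRep₃_of_separable_of_norm_root_eq_one`.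
[cite: Rogawski1990, §3.6 p. 31] [cite: Knapp1986, Ch. V §3] [cite: HornJohnson2013, Thm. 1.3.9] -/
theorem exists_conj_eq_diagonal_of_separable_of_exists_norm_root_ne_one
    {g : GL (Fin 3) ℂ} (hg : g ∈ unitaryGroupOfForm (starRingEnd ℂ) (Matrix.of fun i j : Fin 3 => if i.val + j.val + 1 = 3 then (1 : ℂ) else 0))
    (hsep : (g : Matrix (Fin 3) (Fin 3) ℂ).charpoly.Separable)
    (hnu : ∃ z : ℂ, (g : Matrix (Fin 3) (Fin 3) ℂ).charpoly.IsRoot z ∧ ‖z‖ ≠ 1) :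
    ∃ (h γ : ↥(unitaryGroupOfForm (starRingEnd ℂ) (Matrix.of fun i j : Fin 3 => if i.val + j.val + 1 = 3 then (1 : ℂ) else 0))) (α u : ℂ), α ≠ 0 ∧ ‖α‖ ≠ 1 ∧ ‖u‖ = 1 ∧
      ((γ : GL (Fin 3) ℂ) : Matrix (Fin 3) (Fin 3) ℂ) = !![α, 0, 0; 0, u, 0; 0, 0, (star α)⁻¹] ∧
      (⟨g, hg⟩ : ↥(unitaryGroupOfForm (starRingEnd ℂ) (Matrix.of fun i j : Fin 3 => if i.val + j.val + 1 = 3 then (1 : ℂ) else 0))) = h * γ * h⁻¹ := by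
  classical
  set Φ : Matrix (Fin 3) (Fin 3) ℂ := (Matrix.of fun i j : Fin 3 => if i.val + j.val + 1 = 3 then (1 : ℂ) else 0) with hΦ
  have hΦdet : Φ.det = -1 := det_antidiag₃'
  have hΦH : Φᴴ = Φ := conjTranspose_antidiag₃'
  -- Step A: diagonalise
  obtain ⟨S, d, hS, hSD, hd⟩ :=
    Literature.LinearAlgebra.Matrix.exists_conj_eq_diagonal_of_nodup_roots' (g : Matrix (Fin 3) (Fin 3) ℂ) (Polynomial.nodup_roots hsep)
  have hdroot : ∀ i, (g : Matrix (Fin 3) (Fin 3) ℂ).charpoly.IsRoot (d i) := fun i => by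
    rw [← Polynomial.mem_roots (Matrix.charpoly_monic _).ne_zero, ← hd]
    exact Multiset.mem_map_of_mem _ (Finset.mem_univ_val i)
  have hdinj : Function.Injective d := by
    intro i j h
    have hnd : (Finset.univ.val.map d).Nodup := by rw [hd]; exact Polynomial.nodup_roots hsep
    exact Multiset.inj_on_of_nodup_map hnd i (Finset.mem_univ_val i) j (Finset.mem_univ_val j) h
  have hgS : (g : Matrix (Fin 3) (Fin 3) ℂ) * S = S * diagonal d := by
    have h := congrArg (fun M => S * M) hSD
    simpa only [← Matrix.mul_assoc, Matrix.mul_nonsing_inv _ hS, Matrix.one_mul] using h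
  have hgJ : ((g : Matrix (Fin 3) (Fin 3) ℂ).map (starRingEnd ℂ))ᵀ * Φ * (g : Matrix (Fin 3) (Fin 3) ℂ) = Φ := hg
  -- Step B: the Gram matrix and the partner involution `d̄ᵢ dⱼ = 1` (★ p848127, type (0))
  set Q : Matrix (Fin 3) (Fin 3) ℂ := (S.map (starRingEnd ℂ))ᵀ * Φ * S with hQ
  have hQ' : Q = Sᴴ * Φ * S := by rw [hQ, transpose_map_starRingEnd']
  have hQ0 : ∀ i j, (starRingEnd ℂ (d i) * d j - 1) * Q i j = 0 := fun i j => sub_one_mul_frameGram_apply_eq_zero (starRingEnd ℂ) hgJ hgS i j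
  have hQzero : ∀ i j, starRingEnd ℂ (d i) * d j ≠ 1 → Q i j = 0 := fun i j h => (mul_eq_zero.1 (hQ0 i j)).resolve_left (sub_ne_zero.2 h)
  have hSdet : S.det ≠ 0 := hS.ne_zero
  have hdetQ : Q.det = -((Complex.normSq S.det : ℝ) : ℂ) := by
    rw [hQ', det_mul, det_mul, det_conjTranspose, hΦdet, Complex.normSq_eq_conj_mul_self, Complex.star_def]
    ring
  have hQdet : Q.det ≠ 0 := by
    rw [hdetQ, neg_ne_zero, Complex.ofReal_ne_zero]
    exact (Complex.normSq_pos.2 hSdet).ne'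
  have hQH : Qᴴ = Q := by
    rw [hQ', conjTranspose_mul, conjTranspose_mul, conjTranspose_conjTranspose, hΦH, Matrix.mul_assoc]
  have hpair : ∀ i, ∃ j, starRingEnd ℂ (d i) * d j = 1 := by
    intro i
    by_contra h
    push Not at h
    exact hQdet (Matrix.det_eq_zero_of_row_eq_zero i fun j => hQzero i j (h j))
  have hsymm : ∀ i j, starRingEnd ℂ (d i) * d j = 1 → starRingEnd ℂ (d j) * d i = 1 := by
    intro i j h
    have h' := congrArg (starRingEnd ℂ) h
    rwa [map_mul, Complex.conj_conj, map_one, mul_comm] at h'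
  have huniq : ∀ i j j', starRingEnd ℂ (d i) * d j = 1 → starRingEnd ℂ (d i) * d j' = 1 → j = j' := by
    intro i j j' h h'
    have hci : starRingEnd ℂ (d i) ≠ 0 := fun h0 => by rw [h0, zero_mul] at h; exact zero_ne_one h
    exact hdinj (mul_left_cancel₀ hci (h.trans h'.symm))
  have hnorm1 : ∀ i, starRingEnd ℂ (d i) * d i = 1 → ‖d i‖ = 1 := by
    intro i h
    have h' := congrArg (fun z : ℂ => ‖z‖) h
    simp only [norm_mul, RCLike.norm_conj, norm_one] at h'
    nlinarith [norm_nonneg (d i)]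
  -- Step C: the non-unimodular index `k`, its partner `j ≠ k`, the self-partnered third index `l`
  obtain ⟨z, hz, hz1⟩ := hnu
  obtain ⟨k, hk⟩ : ∃ k, d k = z := by
    have hzmem : z ∈ (g : Matrix (Fin 3) (Fin 3) ℂ).charpoly.roots := (Polynomial.mem_roots (Matrix.charpoly_monic _).ne_zero).2 hz
    rw [← hd] at hzmem
    obtain ⟨k, -, hk⟩ := Multiset.mem_map.1 hzmem
    exact ⟨k, hk⟩
  have hkk : starRingEnd ℂ (d k) * d k ≠ 1 := fun h => hz1 (hk ▸ hnorm1 k h)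
  obtain ⟨j, hkj⟩ := hpair k
  have hjk : starRingEnd ℂ (d j) * d k = 1 := hsymm k j hkj
  have hj_ne_k : j ≠ k := by rintro rfl; exact hkk hkj
  have hthird : ∀ a b : Fin 3, ∃ c : Fin 3, c ≠ a ∧ c ≠ b := by decide
  obtain ⟨l, hl_ne_k, hl_ne_j⟩ := hthird k j
  obtain ⟨m, hlm⟩ := hpair l
  have hm_ne_k : m ≠ k := by
    intro hmk; rw [hmk] at hlm
    exact hl_ne_j (huniq k l j (hsymm l k hlm) hkj)
  have hm_ne_j : m ≠ j := by
    intro hmj; rw [hmj] at hlm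
    exact hl_ne_k (huniq j l k (hsymm l j hlm) hjk)
  have huniq3 : ∀ a b c x : Fin 3, b ≠ a → c ≠ a → c ≠ b → x ≠ a → x ≠ b → x = c := by decide
  have hml : m = l := huniq3 k j l m hj_ne_k hl_ne_k hl_ne_j hm_ne_k hm_ne_j
  have hll : starRingEnd ℂ (d l) * d l = 1 := by rw [hml] at hlm; exact hlm
  have hjj : starRingEnd ℂ (d j) * d j ≠ 1 := fun h => hj_ne_k (huniq j j k h hjk)
  -- Step D: the zero pattern of `Q` (hyperbolic plane on `{k, j}` ⊕ line on `l`) and the two non-zero entries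
  have hQkk : Q k k = 0 := hQzero k k hkk
  have hQjj : Q j j = 0 := hQzero j j hjj
  have hQkl : Q k l = 0 := hQzero k l fun h => hl_ne_j (huniq k l j h hkj)
  have hQlk : Q l k = 0 := hQzero l k fun h => hl_ne_k.symm (huniq l k l h hll)
  have hQlj : Q l j = 0 := hQzero l j fun h => hl_ne_j.symm (huniq l j l h hll)
  have hQjl : Q j l = 0 := hQzero j l fun h => hl_ne_k (huniq j l k h hjk)
  have hQjk : Q j k = starRingEnd ℂ (Q k j) := by
    have h := congrFun (congrFun hQH j) k
    rw [conjTranspose_apply, Complex.star_def] at h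
    exact h.symm
  have hQll_real : ((Q l l).re : ℂ) = Q l l := by
    have h := congrFun (congrFun hQH l) l
    rw [conjTranspose_apply] at h
    exact Complex.conj_eq_iff_re.1 h
  -- `det Q = −|Q_kj|² Q_ll` through the reindexing `(0,1,2) ↦ (k,l,j)`
  have hτinj : Function.Injective (![k, l, j] : Fin 3 → Fin 3) := by
    intro a b hab
    fin_cases a <;> fin_cases b
    · rfl
    · exact absurd hab hl_ne_k.symm
    · exact absurd hab hj_ne_k.symm
    · exact absurd hab hl_ne_k
    · rfl
    · exact absurd hab hl_ne_j
    · exact absurd hab hj_ne_k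
    · exact absurd hab hl_ne_j.symm
    · rfl
  set τ : Fin 3 ≃ Fin 3 := Equiv.ofBijective _ (Finite.injective_iff_bijective.1 hτinj) with hτ
  have hτ0 : τ 0 = k := rfl
  have hτ1 : τ 1 = l := rfl
  have hτ2 : τ 2 = j := rfl
  have hdet' : (Q.submatrix τ τ).det = -(Q k j * starRingEnd ℂ (Q k j) * Q l l) := by
    rw [Matrix.det_fin_three]
    simp only [submatrix_apply, hτ0, hτ1, hτ2, hQkk, hQjj, hQkl, hQlk, hQlj, hQjl, hQjk]
    ring
  have hkey : Q k j * starRingEnd ℂ (Q k j) * Q l l = ((Complex.normSq S.det : ℝ) : ℂ) := by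
    have h1 : (Q.submatrix τ τ).det = Q.det := Matrix.det_submatrix_equiv_self τ Q
    rw [hdet', hdetQ] at h1
    exact neg_injective h1
  have hQkj : Q k j ≠ 0 := by
    intro h0
    rw [h0, zero_mul, zero_mul] at hkey
    exact (Complex.ofReal_ne_zero.2 (Complex.normSq_pos.2 hSdet).ne') hkey.symm
  have hQll_pos : 0 < (Q l l).re := by
    have h1 : Q k j * starRingEnd ℂ (Q k j) = ((Complex.normSq (Q k j) : ℝ) : ℂ) := by rw [Complex.normSq_eq_conj_mul_self]; ring
    rw [h1, ← hQll_real] at hkey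
    have h2 : Complex.normSq (Q k j) * (Q l l).re = Complex.normSq S.det := by exact_mod_cast hkey
    have h3 : 0 < Complex.normSq (Q k j) := Complex.normSq_pos.2 hQkj
    have h4 : 0 < Complex.normSq S.det := Complex.normSq_pos.2 hSdet
    nlinarith
  -- Step E: the rescaled frame `S′ = S E`, columns `(s_k, s_l∕√Q_ll, s_j∕Q_kj)`
  set c : Fin 3 → ℂ := ![1, ((Real.sqrt (Q l l).re)⁻¹ : ℝ), (Q k j)⁻¹] with hc
  set E : Matrix (Fin 3) (Fin 3) ℂ := Matrix.of fun a i => if a = τ i then c i else 0 with hE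
  have hEv : ∀ b i, E b i = if b = τ i then c i else 0 := fun b i => by rw [hE, Matrix.of_apply]
  set S' : Matrix (Fin 3) (Fin 3) ℂ := S * E with hS'
  -- `Eᴴ Q E` entrywise: `(Eᴴ Q E)_{i i'} = c̄_i c_{i'} Q_{τ i, τ i'}`
  have hEQE : ∀ i i', (Eᴴ * Q * E) i i' = starRingEnd ℂ (c i) * c i' * Q (τ i) (τ i') := by
    intro i i'
    rw [Matrix.mul_apply, Finset.sum_eq_single (τ i') (fun b _ hb => by rw [hEv b i', if_neg hb, mul_zero]) (fun h => absurd (Finset.mem_univ _) h),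
      hEv, if_pos rfl, Matrix.mul_apply,
      Finset.sum_eq_single (τ i) (fun b _ hb => by rw [conjTranspose_apply, hEv b i, if_neg hb, star_zero, zero_mul]) (fun h => absurd (Finset.mem_univ _) h),
      conjTranspose_apply, hEv, if_pos rfl, Complex.star_def]
    ring
  have hsq : ((Real.sqrt (Q l l).re : ℝ) : ℂ) ^ 2 = Q l l := by
    rw [← Complex.ofReal_pow, Real.sq_sqrt hQll_pos.le, hQll_real]
  have hsqne : ((Real.sqrt (Q l l).re : ℝ) : ℂ) ≠ 0 := Complex.ofReal_ne_zero.2 (Real.sqrt_pos.2 hQll_pos).ne'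
  have hS'gram : S'ᴴ * Φ * S' = Φ := by
    have e1 : S'ᴴ * Φ * S' = Eᴴ * Q * E := by
      rw [hS', conjTranspose_mul, hQ']
      simp only [Matrix.mul_assoc]
    have hcQ : starRingEnd ℂ (Q k j) ≠ 0 := (map_ne_zero _).2 hQkj
    have e11 : ((Real.sqrt (Q l l).re : ℝ) : ℂ)⁻¹ * ((Real.sqrt (Q l l).re : ℝ) : ℂ)⁻¹ * Q l l = 1 := by
      have h0 : ((Real.sqrt (Q l l).re : ℝ) : ℂ)⁻¹ * ((Real.sqrt (Q l l).re : ℝ) : ℂ)⁻¹ * ((Real.sqrt (Q l l).re : ℝ) : ℂ) ^ 2 = 1 := by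
        field_simp
      simpa only [hsq] using h0
    rw [e1, hΦ, antidiag₃_eq_lit']
    ext i i'
    rw [hEQE]
    fin_cases i <;> fin_cases i' <;>
      simp [hc, hτ0, hτ1, hτ2, hQkk, hQjj, hQkl, hQlk, hQlj, hQjl, hQjk, Complex.conj_ofReal, inv_mul_cancel₀ hQkj, inv_mul_cancel₀ hcQ, e11]
  -- `g S′ = S′ diag(u)`, `u = d ∘ τ`
  set uu : Fin 3 → ℂ := fun i => d (τ i) with huudef
  have hdE : diagonal d * E = E * diagonal uu := by
    ext a i
    rw [diagonal_mul, mul_diagonal, hEv]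
    split_ifs with h
    · subst h; rw [mul_comm]
    · rw [mul_zero, zero_mul]
  have hgS' : (g : Matrix (Fin 3) (Fin 3) ℂ) * S' = S' * diagonal uu := by
    rw [hS', ← Matrix.mul_assoc, hgS, Matrix.mul_assoc, hdE, Matrix.mul_assoc]
  -- Step F: the units
  have hhdet : S'.det ≠ 0 := by
    intro h0
    have h := congrArg Matrix.det hS'gram
    rw [det_mul, det_mul, det_conjTranspose, h0, hΦdet] at h
    norm_num at h
  set hU : GL (Fin 3) ℂ := Matrix.nonsingInvUnit S' (isUnit_iff_ne_zero.2 hhdet) with hhU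
  have hhUval : ((hU : GL (Fin 3) ℂ) : Matrix (Fin 3) (Fin 3) ℂ) = S' := rfl
  have hhUmem : hU ∈ unitaryGroupOfForm (starRingEnd ℂ) Φ := by
    rw [mem_unitaryGroupOfForm_iff, hhUval, transpose_map_starRingEnd']
    exact hS'gram
  -- the eigenvalues: `α = d k`, `u = d l`, `d j = ᾱ⁻¹`
  have hdk0 : d k ≠ 0 := by
    intro h0; rw [h0, map_zero, zero_mul] at hkj; exact zero_ne_one hkj
  have hdj : d j = (starRingEnd ℂ (d k))⁻¹ := eq_inv_of_mul_eq_one_right hkj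
  have huu : uu = ![d k, d l, (starRingEnd ℂ (d k))⁻¹] := by
    funext i
    fin_cases i
    · exact hτ0 ▸ rfl
    · exact hτ1 ▸ rfl
    · show d (τ 2) = _; rw [hτ2, hdj]; rfl
  have hune : ∀ i, uu i ≠ 0 := by
    intro i
    show d (τ i) ≠ 0
    intro h0
    obtain ⟨p, hp⟩ := hpair (τ i)
    rw [h0, map_zero, zero_mul] at hp
    exact zero_ne_one hp
  set γU : GL (Fin 3) ℂ := ⟨diagonal uu, diagonal fun i => (uu i)⁻¹,
      by rw [diagonal_mul_diagonal]; convert diagonal_one with i; exact mul_inv_cancel₀ (hune i),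
      by rw [diagonal_mul_diagonal]; convert diagonal_one with i; exact inv_mul_cancel₀ (hune i)⟩ with hγU
  have hγUval : ((γU : GL (Fin 3) ℂ) : Matrix (Fin 3) (Fin 3) ℂ) = diagonal uu := rfl
  have hγUmem : γU ∈ unitaryGroupOfForm (starRingEnd ℂ) Φ := by
    rw [mem_unitaryGroupOfForm_iff, hγUval, transpose_map_starRingEnd', hΦ, antidiag₃_eq_lit', huu]
    have hck : starRingEnd ℂ (d k) ≠ 0 := (map_ne_zero _).2 hdk0
    ext a b
    fin_cases a <;> fin_cases b <;>
      simp [Matrix.mul_apply, Fin.sum_univ_three, diagonal, conjTranspose_apply, hll, mul_inv_cancel₀ hck, inv_mul_cancel₀ hdk0]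
  refine ⟨⟨hU, hhUmem⟩, ⟨γU, hγUmem⟩, d k, d l, hdk0, by rw [hk]; exact hz1, hnorm1 l hll, by rw [hγUval, huu, diagHyp_lit_eq_diagonal], ?_⟩
  rw [eq_mul_inv_iff_mul_eq]
  apply Subtype.ext
  apply Units.ext
  show (g : Matrix (Fin 3) (Fin 3) ℂ) * S' = S' * diagonal uu
  exact hgS'

end NormalForm

end Literature.NumberTheory.Rogawski1990

end
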